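import Literature.IUT.LogVolume.TensorPacketUnramifiedShell
import HarnessLib

/-!
# Factorwise `ℚ_p`-linear ISOMETRIES and the integral structures `R_I ⊆ (R_I)^∼` of a tensor packet: the positive side

Classical local algebra (nothing disputed; the [IUTchIV] locator records where the abc-iut cell uses it).  [IUTchIV]
Prop. 1.1 p. 9: `R_I = ⊗_{ℤ_p} R_i ⊆ (R_I)^∼` (the normalisation = the maximal `ℤ_p`-order of `V = ⊗_{ℚ_p} k_i`), with
`p^{d_{I*}}·(R_I)^∼ ⊆ R_I` for the differents `d_i` of the factors off one index `*`.  For a family of `ℚ_p`-LINEAR maps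
`g_i : k_i ≃ k_i` (NOT algebra maps; e.g. the (Ind2)-indeterminacies of a log-shell read as «𝒪-stable isometries»):

* `congr_mem_integerPacket_of_norm_le`, **`congr_image_integerPacket_of_norm_eq`** — if every `g_i` has operator norm
  `≤ 1` then `⊗ g_i` maps `R_I` INTO `R_I` (it maps each generating pure tensor `⊗ x_i`, `‖x_i‖ ≤ 1`, to the pure tensor
  `⊗ g_i x_i` of integers; abc-iut-S1's `integerPacket_induction`); if every `g_i` is an ISOMETRY, ONTO `R_I`;
* **`integerPacket_eq_normalizedPacket_of_unramified_off`** — `R_I = (R_I)^∼` as soon as every factor OFF ONE index `*` is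
  absolutely unramified (`e_i = 1`, `i ≠ *`; the factor `k_*` arbitrary): Prop. 1.1's first inclusion with all `δ_i = 1`
  (abc-iut-S5's `purePacket_mul_mem_integerPacket`, abc-iut-S6's `different_eq_top_of_absRamificationIdx_eq_one`) — the
  «at most ONE ramified factor» refinement of abc-iut-w5's `integerPacket_eq_normalizedPacket_of_unramified`;
* **`congr_image_normalizedPacket_of_norm_eq_of_unramified_off`** — hence at such packets EVERY family of factorwise
  `ℚ_p`-linear isometries maps the maximal order `(R_I)^∼` onto itself (and `c·(R_I)^∼` onto itself for every scalar `c`,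
  `congr_image_smul_normalizedPacket_…`).

Use (abc-iut cell, R-J row Y-29b, positive side): the maximal-order MOVERS of `WildCubicIsometryMover` (ℚ₃(∛3), abc-iut-E-t47)
and `WildQuadraticIsometryMover` (ℚ₂(√2), this seat) need at least TWO ramified factors in the summand; the located TAME
statement («the maximal order of a tame packet is the unit ball of the tensor norm, hence isometry-stable») is NOT proved here.
A statement about CONTAINERS only; it takes no side on [IUTchIII] Cor. 3.12.  Proof-only file (theorems, no definitions).
[cite: Mochizuki2012, IUTchIV Prop. 1.1 p. 9, Prop. 1.2 (iv) p. 11] [cite: SerreLocalFields1979, Ch. III §6 Prop. 13]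
-/

noncomputable section

open Set
open scoped TensorProduct Pointwise NormedField

namespace Literature.IUT.LogVolume

variable (p : ℕ) [Fact p.Prime]
variable {I : Type} [Fintype I] [DecidableEq I]
variable (k : I → Type) [∀ i, NontriviallyNormedField (k i)] [∀ i, NormedAlgebra ℚ_[p] (k i)]

/-! ## `⊗ g_i` maps `R_I` into / onto `R_I` -/

omit [Fintype I] [DecidableEq I] in
/-- **Factorwise maps of operator norm `≤ 1` map `R_I` into `R_I`**: `(⊗ g_i)(⊗ x_i) = ⊗ g_i x_i` is a pure tensor of
integers when `‖x_i‖ ≤ 1`, and `R_I` is additively generated by such pure tensors. [cite: Mochizuki2012, IUTchIV Prop. 1.1 p. 9] -/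
theorem congr_mem_integerPacket_of_norm_le (g : ∀ i, k i ≃ₗ[ℚ_[p]] k i) (hg : ∀ i x, ‖g i x‖ ≤ ‖x‖)
    {t : PacketAlgebra p k} (ht : t ∈ integerPacket p k) :
    (PiTensorProduct.congr g : PacketAlgebra p k ≃ₗ[ℚ_[p]] PacketAlgebra p k) t ∈ integerPacket p k := by
  refine integerPacket_induction p k
    (C := fun t => (PiTensorProduct.congr g : PacketAlgebra p k ≃ₗ[ℚ_[p]] PacketAlgebra p k) t ∈ integerPacket p k)
    ?_ ?_ ?_ ?_ ht
  · intro x hx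
    rw [purePacket, PiTensorProduct.congr_tprod]
    exact purePacket_mem_integerPacket p k fun i => (hg i (x i)).trans (hx i)
  · rw [map_zero]; exact zero_mem _
  · intro a b ha hb; rw [map_add]; exact add_mem ha hb
  · intro a ha; rw [map_neg]; exact neg_mem ha

omit [Fintype I] [DecidableEq I] in
/-- The inverse family: `(⊗ g_i)⁻¹` maps `R_I` into `R_I` when every `g_i⁻¹` has operator norm `≤ 1`.
[cite: Mochizuki2012, IUTchIV Prop. 1.1 p. 9] -/
theorem congr_symm_mem_integerPacket_of_norm_le (g : ∀ i, k i ≃ₗ[ℚ_[p]] k i) (hg : ∀ i x, ‖(g i).symm x‖ ≤ ‖x‖)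
    {t : PacketAlgebra p k} (ht : t ∈ integerPacket p k) :
    (PiTensorProduct.congr g : PacketAlgebra p k ≃ₗ[ℚ_[p]] PacketAlgebra p k).symm t ∈ integerPacket p k := by
  refine integerPacket_induction p k
    (C := fun t => (PiTensorProduct.congr g : PacketAlgebra p k ≃ₗ[ℚ_[p]] PacketAlgebra p k).symm t ∈ integerPacket p k)
    ?_ ?_ ?_ ?_ ht
  · intro x hx
    rw [purePacket, PiTensorProduct.congr_symm_tprod]
    exact purePacket_mem_integerPacket p k fun i => (hg i (x i)).trans (hx i)
  · rw [map_zero]; exact zero_mem _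
  · intro a b ha hb; rw [map_add]; exact add_mem ha hb
  · intro a ha; rw [map_neg]; exact neg_mem ha

omit [Fintype I] [DecidableEq I] in
/-- **Factorwise `ℚ_p`-linear ISOMETRIES map `R_I` ONTO `R_I`.** [cite: Mochizuki2012, IUTchIV Prop. 1.1 p. 9] -/
theorem congr_image_integerPacket_of_norm_eq (g : ∀ i, k i ≃ₗ[ℚ_[p]] k i) (hg : ∀ i x, ‖g i x‖ = ‖x‖) :
    (PiTensorProduct.congr g : PacketAlgebra p k ≃ₗ[ℚ_[p]] PacketAlgebra p k) ''
        (integerPacket p k : Set (PacketAlgebra p k)) = integerPacket p k := by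
  have hg' : ∀ i x, ‖(g i).symm x‖ ≤ ‖x‖ := fun i x => by
    conv_rhs => rw [← (g i).apply_symm_apply x, hg i]
  apply Set.Subset.antisymm
  · rintro _ ⟨t, ht, rfl⟩
    exact congr_mem_integerPacket_of_norm_le p k g (fun i x => (hg i x).le) ht
  · intro t ht
    exact ⟨_, congr_symm_mem_integerPacket_of_norm_le p k g hg' ht, (PiTensorProduct.congr g).apply_symm_apply t⟩

/-! ## `R_I = (R_I)^∼` when every factor off one index is absolutely unramified -/

section Unramified

variable [∀ i, IsUltrametricDist (k i)] [∀ i, ProperSpace (k i)]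

/-- **`R_I = (R_I)^∼` when all factors OFF ONE index `*` are absolutely unramified** (`e_i = 1` for `i ≠ *`, `k_*` arbitrary,
any `|I|`): the differents `𝔇_i`, `i ≠ *`, are trivial (abc-iut-S6), so [IUTchIV] Prop. 1.1's `(⊗_i δ_i)·(R_I)^∼ ⊆ R_I`
(abc-iut-S5's `purePacket_mul_mem_integerPacket`, `δ_* = 1`) holds with every `δ_i = 1`.
[cite: Mochizuki2012, IUTchIV Prop. 1.1 p. 9] [cite: SerreLocalFields1979, Ch. III §6 Prop. 13] -/
theorem integerPacket_eq_normalizedPacket_of_unramified_off (star : I)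
    (he : ∀ i, i ≠ star → absRamificationIdx p (k i) = 1) : integerPacket p k = normalizedPacket p k := by
  refine le_antisymm (integerPacket_le_normalizedPacket p k) fun x hx => ?_
  have h := purePacket_mul_mem_integerPacket p k star (fun _ => 1)
    (fun i hi => by rw [different_eq_top_of_absRamificationIdx_eq_one p (k i) (he i hi)]; simp) rfl hx
  have h1 : purePacket p k (fun i => ((1 : Valued.integer (k i)) : k i)) = 1 := by
    have : (fun i => ((1 : Valued.integer (k i)) : k i)) = 1 := funext fun _ => rfl
    rw [this, purePacket_one]
  rwa [h1, one_mul] at h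

/-- **At such packets, factorwise `ℚ_p`-linear ISOMETRIES map the maximal order `(R_I)^∼` onto itself.**  (With two or
more ramified factors this FAILS: `WildCubicIsometryMover`, `WildQuadraticIsometryMover`.) [cite: Mochizuki2012, IUTchIV Prop. 1.1 p. 9] -/
theorem congr_image_normalizedPacket_of_norm_eq_of_unramified_off (star : I)
    (he : ∀ i, i ≠ star → absRamificationIdx p (k i) = 1) (g : ∀ i, k i ≃ₗ[ℚ_[p]] k i)
    (hg : ∀ i x, ‖g i x‖ = ‖x‖) :
    (PiTensorProduct.congr g : PacketAlgebra p k ≃ₗ[ℚ_[p]] PacketAlgebra p k) ''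
        (normalizedPacket p k : Set (PacketAlgebra p k)) = normalizedPacket p k := by
  rw [← integerPacket_eq_normalizedPacket_of_unramified_off p k star he]
  exact congr_image_integerPacket_of_norm_eq p k g hg

/-- … and `c·(R_I)^∼` onto itself, for every `c ∈ V` commuting past `⊗ g_i` — in particular every SCALAR `c ∈ ℚ_p` (the
boxes `p^λ·(R_I)^∼`, `n·(R_I)^∼` of the honest settings). [cite: Mochizuki2012, IUTchIV Prop. 1.1 p. 9] -/
theorem congr_image_smul_normalizedPacket_of_norm_eq_of_unramified_off (star : I)
    (he : ∀ i, i ≠ star → absRamificationIdx p (k i) = 1) (g : ∀ i, k i ≃ₗ[ℚ_[p]] k i)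
    (hg : ∀ i x, ‖g i x‖ = ‖x‖) (c : ℚ_[p]) :
    (PiTensorProduct.congr g : PacketAlgebra p k ≃ₗ[ℚ_[p]] PacketAlgebra p k) ''
        (c • (normalizedPacket p k : Set (PacketAlgebra p k))) = c • (normalizedPacket p k : Set (PacketAlgebra p k)) := by
  conv_rhs => rw [← congr_image_normalizedPacket_of_norm_eq_of_unramified_off p k star he g hg]
  rw [← Set.image_smul, ← Set.image_smul, Set.image_image, Set.image_image]
  exact Set.image_congr fun v _ => map_smul _ c v

/-- The natural-number boxes `n·(R_I)^∼` (`n ∈ ℕ` acting through `V`) are fixed as well. [cite: Mochizuki2012, IUTchIV Prop. 1.1 p. 9] -/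
theorem congr_image_natCast_smul_normalizedPacket_of_norm_eq_of_unramified_off (star : I)
    (he : ∀ i, i ≠ star → absRamificationIdx p (k i) = 1) (g : ∀ i, k i ≃ₗ[ℚ_[p]] k i)
    (hg : ∀ i x, ‖g i x‖ = ‖x‖) (n : ℕ) :
    (PiTensorProduct.congr g : PacketAlgebra p k ≃ₗ[ℚ_[p]] PacketAlgebra p k) ''
        ((n : PacketAlgebra p k) • (normalizedPacket p k : Set (PacketAlgebra p k))) =
      (n : PacketAlgebra p k) • (normalizedPacket p k : Set (PacketAlgebra p k)) := by
  have hn : (n : PacketAlgebra p k) • (normalizedPacket p k : Set (PacketAlgebra p k)) =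
      (n : ℚ_[p]) • (normalizedPacket p k : Set (PacketAlgebra p k)) := by
    ext v
    simp only [Set.mem_smul_set, smul_eq_mul]
    constructor
    · rintro ⟨w, hw, rfl⟩; exact ⟨w, hw, by rw [Algebra.smul_def, map_natCast]⟩
    · rintro ⟨w, hw, rfl⟩; exact ⟨w, hw, by rw [Algebra.smul_def, map_natCast]⟩
  rw [hn]
  exact congr_image_smul_normalizedPacket_of_norm_eq_of_unramified_off p k star he g hg n

end Unramified

end Literature.IUT.LogVolume

end
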